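import Summits.QuantumFields.YangMills.Theorems.BalabanUVNodesN18KingModelDens
import Literature.MathematicalPhysics.QuantumFieldTheory.King1986.CovarianceQstar

/-!
# BalabanUVNodes ∕ node N18 (NE5 bracket) — DENS_cl⁰ AT KING'S ACTUAL UNIT-TORUS OPERATORS: the two runs' block-RG effective Laplacians `Δ^{(k)}`, `Δ^{(k+n)}`
# (`King1986.Torus.effLaplacian`, (4.5) as an operator identity) on every unit torus `Π ℤ/M_μ`, their Gaussian vacuum densities pointwise-sandwiched on the small-field
# classes with the GEOMETRIC radius `θ_k·a·M₀/2` — and N19's dressed `Core` ∕ N14's binder there BY NAME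

Cell `pub-ymgap`, HUMAN RULING D-0062 (Track A), R134 ACCELERATION seat `pub-ymgap-dag-n14-c` re-pointed to **N18-b** (dag-lead REBALANCE №67), generation 6, second N18 module;
route `Summits/QuantumFields/YangMills/Theses/BalabanUVNodes.lean` rev 18∕19 (cluster K3⁗ `SpineGivenEndpointR13Sep` = stmt-QuantumFields-20292, `--supports … --as helper`); venue
ruling R424 (`YangMills/Theorems`, namespace `YMDAG.N18.KingModelDensTorus`).  ADDITIVE — imports this seat's `…N18KingModelDens` (the abstract producer: (3.91) operator ∕ symbol form ⇒
DENS_cl⁰ ⇒ n19-d's `core_dressed_of_vacuumDens` ∕ `tiltedMeanMatching_of_vacuumDens`) and the tree's `King1986/CovarianceQstar` (`Torus.effLaplacian_coercive`); through them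
`King1986/EffectiveLaplacianSymbol` (★ `Torus.effLaplacian`, ★ `Torus.effLaplacian_form_DeltaEff` = (4.5)∕(4.35) as an operator identity), `King1986/TorusBlockForm` (`Torus.ft`,
`Torus.parseval_dot`), `King1986/CovarianceRateTorus` (★ `Torus.abs_DeltaEff_sub_le_thetaK` = Prop. 3.10 (3.91) at EVERY zone momentum incl. `0`, `Torus.thetaK_le`),
`Balaban1983to89/B5Prop11Plancherel` (`Tor`, `sOf`, `abs_sOf_le`) — all CITED, nothing re-proved; THEOREMS ONLY (0 `def`), modifies nothing.

WHAT THIS FILE ADDS TO `…N18KingModelDens`.  There the King model entered through HYPOTHESES — «both effective Laplacians diagonal in a common orthonormal basis with the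
`DeltaEff` symbols» on an abstract inner-product space.  Here the operators ARE King's: `ΔA = Torus.effLaplacian (L^k) M (a_k) ((L^k)²) m²` and `ΔB = Torus.effLaplacian (L^n·L^k) M
(a_{k+n}) ((L^n·L^k)²) m²`, real matrices on the unit torus `Tor M = Π_μ ℤ/M_μ` (the block-RG effective quadratic forms after `k`, resp. `k+n`, averaging steps from the fine tori
`Π ℤ/(L^kM_μ)`, `Π ℤ/(L^{k+n}M_μ)` — King's two runs READ ON THE SAME UNIT LATTICE), and the symbol form is the tree's THEOREM `effLaplacian_form_DeltaEff` (Plancherel), so the only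
hypotheses left are the class support (`φ ⬝ᵥ φ ≤ M₀` a.e. on the good classes' reference pieces — King's (3.2) small-field condition at the unit scale) and the data `a > 0`, `m² > 0`,
`L ≥ 2`, `k, n ≥ 1`:
* §1 [folklore] THE ACTION-LEVEL PRODUCER (currency-free twin of `KingModelDens` §1): `vacuumDens_of_actionBound` (ANY two measurable actions with `|S_A − S_B| ≤ r_K` a.e. on the good
  classes ⇒ DENS_cl⁰, centre `0`), `measurable_exp_neg` ∕ `integrable_exp_neg_of_nonneg`, ★ `core_of_actionBound`, ★ `tiltedMeanMatching_of_actionBound` (n19-d's two theorems, ONE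
  application each).
* §2 [cite ∘ folklore] KING'S TWO RUNS ON THE UNIT TORUS: `measurable_dotProduct_mulVec`, `dotProduct_effLaplacian_nonneg` (`Torus.effLaplacian_coercive`), ★★ **`abs_action_sub_le_torus`**
  (`|½φ·Δ^{(k)}φ − ½φ·Δ^{(k+n)}φ| ≤ θ_k·a·(φ ⬝ᵥ φ)/2` for EVERY `φ : Tor M → ℝ` — `effLaplacian_form_DeltaEff` for both runs + `abs_DeltaEff_sub_le_thetaK` per momentum + `parseval_dot`;
  this IS (3.92) at the operators, with King's `(p/μ₀)²|T|` replaced by the class letter); `abs_action_sub_le_torus_of_eq` (run B's size ∕ count presented by equations).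
* §3 [folklore ∘ §1–§2] ★★ **`vacuumDens_kingTorus`** (DENS_cl⁰ for King's Gaussian effective densities `exp(−½φ·Δ^{(k_K)}φ)`, `exp(−½φ·Δ^{(k_K+n)}φ)` on reference pieces carried by
  `φ ⬝ᵥ φ ≤ M₀`, radius `r_K = θ_{k_K}·a·M₀/2`), ★★ **`core_kingTorus`** (N19's dressed `Spine.NE7.Core`, every source `t`, any `vol·δ_K ≥ r_K`), ★★ **`tiltedMeanMatching_kingTorus`**
  (N14's binder with `η_K = B(e^{2r_K} − 1)`); with `k_K = K + 1` both rates are SUMMABLE by `KingModelDens.summable_kingRadius` (geometric, `thetaK_le`).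
* §4 [folklore ∘ §3] THE SMALL-FIELD BOX AS THE REFERENCE PIECE (no measure hypothesis left): `smallField_eq_Icc`, `dotProduct_self_le_of_abs_le`, `volume_smallField_lt_top`,
  `ae_dotProduct_le_smallField`, ★★ **`core_kingTorus_smallField`** ∕ ★★ **`tiltedMeanMatching_kingTorus_smallField`** — Lebesgue measure on King's (3.2) class `|φ(x)| ≤ R` for EVERY good
  class: `Core` (every `t`) and N14's binder with radius `θ_{k_K}·a·R²·|Tor M|/2`, hypotheses = the model's data (`a, m² > 0`, `L ≥ 2`, `k_K, n ≥ 1`) and a bounded observable ONLY;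
  ★★ **`exists_core_summable_kingTorus_smallField`** — consecutive runs (`k_K = K + 1`): `∃ δ, Core … δ ∧ Summable δ`, the K3⁗ skeleton's keyed-core-edge conclusion SHAPE, INHABITED in
  the printed model with `δ_K = θ_{K+1}·a·R²|Tor M|/(2vol)`.

HONEST FRAMING.  King's `A = 0` scalar MODEL with periodic boundary conditions and `m² > 0` ([King1986] (2.4)–(2.6), (4.5), Prop. 3.10; template literature; the tree's
`effLaplacian` is the flat-block-profile torus version the cell's King files prove everything for) — NOT Bałaban's non-abelian class densities (DENS_cl⁰ = NE7 proper there, NOT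
PRINTED; producers = NODE O ∕ U3 objects); the large-field classes (`Bad`), the class index and the reference pieces are PARAMETERS; nothing of Bałaban's is instantiated or
asserted.  Everything is PROVED (0 `sorry`, 0 named facts); count-neutral; N18 ∕ N19 ∕ N14 NOT discharged; counts UNMOVED.  One finite four-torus programme at fixed ε; NOT ℝ⁴, NOT OS,
NOT a mass gap, NOT Clay.
-/

noncomputable section

namespace YMDAG.N18.KingModelDensTorus

open MeasureTheory Set Filter Finset Real Matrix
open scoped ENNReal BigOperators
open Summit.QuantumFields.BalabanUV.T4Continuum.NE1p.DressedMGFForm (TiltedMeanMatching)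
open Summit.QuantumFields.BalabanUV.T4Continuum.Spine.NE7 (Core)
open Summit.QuantumFields.YangMills.BalabanUVNodes.N19DensityRoad (core_dressed_of_vacuumDens tiltedMeanMatching_of_vacuumDens)
open YMDAG.N18.KingModelDens (exp_neg_sandwich_of_abs_sub_le kingTheta_nonneg summable_kingRadius)
open Literature.MathematicalPhysics.QuantumFieldTheory.King1986 (DeltaEff aK thetaK aK_le aK_pos)
open Literature.MathematicalPhysics.QuantumFieldTheory.King1986.Torus (effLaplacian effLaplacian_form_DeltaEff parseval_dot ft abs_DeltaEff_sub_le_thetaK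
  effLaplacian_coercive)
open Literature.MathematicalPhysics.QuantumFieldTheory.Balaban1983to89.B5Prop11Plancherel (Tor sOf abs_sOf_le)

/-! ## §1 The action-level producer: any two actions `r_K`-close on the good classes give DENS_cl⁰, the dressed `Core` and N14's binder -/
section Action

variable {E : Type*} [MeasurableSpace E] {ι : Type*} [DecidableEq ι] {l₀ vol B : ℝ} {T : ℕ → Finset ι} {Bad : ℕ → ℝ → Finset ι} {W : ℕ → E → ℝ}
  {μ : ℕ → ι → Measure E} {SA SB : ℕ → E → ℝ} {r δ : ℕ → ℝ} {P Q : ℕ → ℝ → ι → ℝ}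

/-- **DENS_cl⁰ FROM AN ACTION BOUND** [folklore]: two actions `r_K`-close a.e. on the good classes' reference pieces have pointwise-sandwiched Boltzmann factors, centre `0`,
radius `r_K` — the hypothesis `hD` of n19-d's `core_dressed_of_vacuumDens` ∕ `tiltedMeanMatching_of_vacuumDens`, in any currency for the actions. -/
theorem vacuumDens_of_actionBound (h : ∀ (K : ℕ) (t : ℝ), |t| ≤ l₀ → ∀ τ ∈ T K \ Bad K t, ∀ᵐ ψ ∂(μ K τ), |SA K ψ - SB K ψ| ≤ r K) :
    ∀ K : ℕ, ∃ c : ℝ, ∀ t : ℝ, |t| ≤ l₀ → ∀ τ ∈ T K \ Bad K t, ∀ᵐ ψ ∂(μ K τ),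
      Real.exp (c - r K) * Real.exp (-SA K ψ) ≤ Real.exp (-SB K ψ) ∧ Real.exp (-SB K ψ) ≤ Real.exp (c + r K) * Real.exp (-SA K ψ) :=
  fun K => ⟨0, fun t ht τ hτ => (h K t ht τ hτ).mono fun _ hψ => exp_neg_sandwich_of_abs_sub_le hψ⟩

/-- Measurability of a Boltzmann factor. [folklore] -/
theorem measurable_exp_neg {S : E → ℝ} (hS : Measurable S) : Measurable fun ψ => Real.exp (-S ψ) :=
  Real.measurable_exp.comp hS.neg

/-- On a finite reference piece the Boltzmann factor of a nonnegative action is integrable (`≤ 1`). [folklore] -/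
theorem integrable_exp_neg_of_nonneg {ν : Measure E} [IsFiniteMeasure ν] {S : E → ℝ} (hS : Measurable S) (h0 : ∀ ψ, 0 ≤ S ψ) :
    Integrable (fun ψ => Real.exp (-S ψ)) ν := by
  refine (integrable_const (1 : ℝ)).mono' (measurable_exp_neg hS).aestronglyMeasurable (Eventually.of_forall fun ψ => ?_)
  rw [Real.norm_eq_abs, abs_of_pos (Real.exp_pos _), Real.exp_le_one_iff]
  linarith [h0 ψ]

/-- **★ THE DRESSED `Core` FROM AN ACTION BOUND** [folklore ∘ n19-d `core_dressed_of_vacuumDens`]: measurable nonnegative actions `r_K`-close a.e. on the good classes, finite reference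
pieces, a `B`-bounded measurable observable family and the dressed class partition functions `P = ∫ e^{−S_A}e^{tW} dμ`, `Q = ∫ e^{−S_B}e^{tW} dμ` give `Core l₀ vol T Bad P Q δ` for any
`vol·δ_K ≥ r_K`, every source `t`. -/
theorem core_of_actionBound (hSA : ∀ K, Measurable (SA K)) (hSB : ∀ K, Measurable (SB K)) (hA0 : ∀ K ψ, 0 ≤ SA K ψ) (hB0 : ∀ K ψ, 0 ≤ SB K ψ)
    (h : ∀ (K : ℕ) (t : ℝ), |t| ≤ l₀ → ∀ τ ∈ T K \ Bad K t, ∀ᵐ ψ ∂(μ K τ), |SA K ψ - SB K ψ| ≤ r K)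
    (hfin : ∀ K, ∀ τ ∈ T K, IsFiniteMeasure (μ K τ)) (hB : 0 ≤ B) (hWm : ∀ K, Measurable (W K)) (hWb : ∀ K ψ, |W K ψ| ≤ B)
    (hP : ∀ K (t : ℝ), ∀ τ ∈ T K, P K t τ = ∫ ψ, Real.exp (-SA K ψ) * Real.exp (t * W K ψ) ∂(μ K τ))
    (hQ : ∀ K (t : ℝ), ∀ τ ∈ T K, Q K t τ = ∫ ψ, Real.exp (-SB K ψ) * Real.exp (t * W K ψ) ∂(μ K τ)) (hδ : ∀ K, r K ≤ vol * δ K) :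
    Core l₀ vol T Bad P Q δ :=
  core_dressed_of_vacuumDens (Ω := fun _ => E) (μ := μ) (fA := fun K _ ψ => Real.exp (-SA K ψ)) (fB := fun K _ ψ => Real.exp (-SB K ψ)) hB hWm hWb
    (fun K _ => measurable_exp_neg (hSA K)) (fun K _ ψ => (Real.exp_pos _).le)
    (fun K τ hτ => by haveI := hfin K τ hτ; exact integrable_exp_neg_of_nonneg (hSA K) (hA0 K))
    (fun K _ => measurable_exp_neg (hSB K)) (fun K _ ψ => (Real.exp_pos _).le)
    (fun K τ hτ => by haveI := hfin K τ hτ; exact integrable_exp_neg_of_nonneg (hSB K) (hB0 K)) hP hQ (vacuumDens_of_actionBound h) hδ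

/-- **★ N14's BINDER FROM AN ACTION BOUND** [folklore ∘ n19-d `tiltedMeanMatching_of_vacuumDens`]: the same data (run A's action nonnegative for finiteness; `0 ≤ r`) give
`TiltedMeanMatching … (K ↦ B·(e^{2r_K} − 1))` for the class laws `μ_{K,τ}.withDensity e^{−S_X}`. -/
theorem tiltedMeanMatching_of_actionBound (hSA : ∀ K, Measurable (SA K)) (hSB : ∀ K, Measurable (SB K)) (hA0 : ∀ K ψ, 0 ≤ SA K ψ) (hr : ∀ K, 0 ≤ r K)
    (h : ∀ (K : ℕ) (t : ℝ), |t| ≤ l₀ → ∀ τ ∈ T K \ Bad K t, ∀ᵐ ψ ∂(μ K τ), |SA K ψ - SB K ψ| ≤ r K)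
    (hfin : ∀ K, ∀ τ ∈ T K, IsFiniteMeasure (μ K τ)) (hB : 0 ≤ B) (hWm : ∀ K, Measurable (W K)) (hWb : ∀ K ψ, |W K ψ| ≤ B) :
    TiltedMeanMatching l₀ T Bad W (fun K τ => (μ K τ).withDensity fun ψ => ENNReal.ofReal (Real.exp (-SA K ψ))) W
      (fun K τ => (μ K τ).withDensity fun ψ => ENNReal.ofReal (Real.exp (-SB K ψ))) fun K => B * (Real.exp (2 * r K) - 1) := by
  have hD := vacuumDens_of_actionBound (μ := μ) h
  refine tiltedMeanMatching_of_vacuumDens (Ω := fun _ => E) (μ := μ) (fA := fun K _ ψ => Real.exp (-SA K ψ)) (fB := fun K _ ψ => Real.exp (-SB K ψ)) hr hB hWm hWb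
    (fun K _ => measurable_exp_neg (hSA K)) (fun K _ => measurable_exp_neg (hSB K))
    (fun K τ hτ => by haveI := hfin K τ hτ; exact integrable_exp_neg_of_nonneg (hSA K) (hA0 K)) fun K t ht τ hτ => ?_
  obtain ⟨c, hc⟩ := hD K
  exact ⟨c, hc t ht τ hτ⟩

end Action

/-! ## §2 King's two runs on the unit torus: `|½φ·Δ^{(k)}φ − ½φ·Δ^{(k+n)}φ| ≤ θ_k·a·(φ ⬝ᵥ φ)/2` -/
section TorusRuns

variable {d : ℕ} (M : Fin d → ℕ) [hM : ∀ μ, NeZero (M μ)]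

/-- A quadratic form `φ ↦ φ ⬝ᵥ (Δ *ᵥ φ)` on a finite lattice is measurable (a polynomial in the coordinates). [folklore] -/
theorem measurable_dotProduct_mulVec (Δ : Matrix (Tor M) (Tor M) ℝ) : Measurable fun φ : Tor M → ℝ => φ ⬝ᵥ (Δ *ᵥ φ) := by
  have h : (fun φ : Tor M → ℝ => φ ⬝ᵥ (Δ *ᵥ φ)) = fun φ => ∑ i, φ i * ∑ j, Δ i j * φ j := by
    ext φ
    simp [dotProduct, Matrix.mulVec]
  rw [h]
  fun_prop

/-- King's effective Laplacian is a NONNEGATIVE form (coercive with constant `(a⁻¹ + m⁻²)⁻¹ > 0`, tree `Torus.effLaplacian_coercive`). [cite: King1986, (4.33)–(4.35) p.674] -/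
theorem dotProduct_effLaplacian_nonneg (N : ℕ) [NeZero N] (hN1 : 1 ≤ N) {a m2 : ℝ} (ha : 0 < a) (hm : 0 < m2) (φ : Tor M → ℝ) :
    0 ≤ φ ⬝ᵥ (effLaplacian N M a ((N : ℝ) ^ 2) m2 *ᵥ φ) := by
  have hc := effLaplacian_coercive N M hN1 ha hm φ
  have h0 : 0 ≤ (a⁻¹ + m2⁻¹)⁻¹ * (φ ⬝ᵥ φ) := by
    have : 0 ≤ φ ⬝ᵥ φ := by
      rw [dotProduct]
      exact Finset.sum_nonneg fun i _ => mul_self_nonneg _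
    positivity
  exact h0.trans hc

/-- **★★ (3.92) AT KING'S OPERATORS, EVERY TORUS AND EVERY FIELD** [cite ∘ folklore]: for `L ≥ 2`, `k, n ≥ 1`, `a > 0`, `m² > 0`,
`|½·φ·Δ^{(k)}φ − ½·φ·Δ^{(k+n)}φ| ≤ θ_k·a·(φ ⬝ᵥ φ)/2` with King's `θ_k = thetaK a L k n = 2a_k(a_n⁻¹ + π²/48 + 1/3)L^{−2k}` — both forms in plane waves
(`effLaplacian_form_DeltaEff`), Prop. 3.10 per momentum incl. the zero mode (`abs_DeltaEff_sub_le_thetaK`), Plancherel (`parseval_dot`).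
[cite: King1986, Prop 3.10 (3.91)–(3.92) p.669; (4.35) p.674] -/
theorem abs_action_sub_le_torus {a : ℝ} (ha : 0 < a) {L k n : ℕ} [NeZero L] (hL : 2 ≤ L) (hk : 1 ≤ k) (hn : 1 ≤ n) {m2 : ℝ} (hm : 0 < m2) (φ : Tor M → ℝ) :
    |φ ⬝ᵥ (effLaplacian (L ^ k) M (aK a L k) (((L ^ k : ℕ) : ℝ) ^ 2) m2 *ᵥ φ) / 2 -
        φ ⬝ᵥ (effLaplacian (L ^ n * L ^ k) M (aK a L (k + n)) (((L ^ n * L ^ k : ℕ) : ℝ) ^ 2) m2 *ᵥ φ) / 2|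
      ≤ thetaK a L k n * a * (φ ⬝ᵥ φ) / 2 := by
  have hL1 : (1 : ℝ) < L := by exact_mod_cast hL
  have hL0 : L ≠ 0 := NeZero.ne L
  have hNk : 1 ≤ L ^ k := Nat.one_le_pow k L (Nat.pos_of_ne_zero hL0)
  have hNkn : 1 ≤ L ^ n * L ^ k := Nat.one_le_iff_ne_zero.2 (Nat.mul_ne_zero (pow_ne_zero n hL0) (pow_ne_zero k hL0))
  have hcard : (0 : ℝ) < Fintype.card (Tor M) := by exact_mod_cast Fintype.card_pos
  have hA := effLaplacian_form_DeltaEff (L ^ k) M hNk (aK_pos ha hL1 hk) hm φ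
  have hB := effLaplacian_form_DeltaEff (L ^ n * L ^ k) M hNkn (aK_pos ha hL1 (by omega : 1 ≤ k + n)) hm φ
  have hP := parseval_dot M φ
  -- the difference of the two forms, in plane waves
  have hdiff : (Fintype.card (Tor M) : ℝ) *
      (φ ⬝ᵥ (effLaplacian (L ^ k) M (aK a L k) (((L ^ k : ℕ) : ℝ) ^ 2) m2 *ᵥ φ) -
        φ ⬝ᵥ (effLaplacian (L ^ n * L ^ k) M (aK a L (k + n)) (((L ^ n * L ^ k : ℕ) : ℝ) ^ 2) m2 *ᵥ φ))
      = ∑ q : Tor M, (DeltaEff (aK a L k) (L ^ k) m2 (sOf M q) - DeltaEff (aK a L (k + n)) (L ^ n * L ^ k) m2 (sOf M q)) * ‖ft M φ q‖ ^ 2 := by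
    rw [mul_sub, hA, hB, ← Finset.sum_sub_distrib]
    exact Finset.sum_congr rfl fun q _ => by ring
  have hbound : |∑ q : Tor M, (DeltaEff (aK a L k) (L ^ k) m2 (sOf M q) - DeltaEff (aK a L (k + n)) (L ^ n * L ^ k) m2 (sOf M q)) * ‖ft M φ q‖ ^ 2|
      ≤ thetaK a L k n * a * ∑ q : Tor M, ‖ft M φ q‖ ^ 2 := by
    refine (Finset.abs_sum_le_sum_abs _ _).trans ?_
    rw [Finset.mul_sum]
    refine Finset.sum_le_sum fun q _ => ?_
    rw [abs_mul, abs_of_nonneg (sq_nonneg ‖ft M φ q‖)]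
    exact mul_le_mul_of_nonneg_right (abs_DeltaEff_sub_le_thetaK ha hL hk hn hm (abs_sOf_le M q)) (sq_nonneg _)
  rw [← hdiff, ← hP, abs_mul, abs_of_pos hcard] at hbound
  have hkey : |φ ⬝ᵥ (effLaplacian (L ^ k) M (aK a L k) (((L ^ k : ℕ) : ℝ) ^ 2) m2 *ᵥ φ) -
        φ ⬝ᵥ (effLaplacian (L ^ n * L ^ k) M (aK a L (k + n)) (((L ^ n * L ^ k : ℕ) : ℝ) ^ 2) m2 *ᵥ φ)| ≤ thetaK a L k n * a * (φ ⬝ᵥ φ) := by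
    have := hbound
    rw [show thetaK a L k n * a * ((Fintype.card (Tor M) : ℝ) * (φ ⬝ᵥ φ)) = (Fintype.card (Tor M) : ℝ) * (thetaK a L k n * a * (φ ⬝ᵥ φ)) by ring] at this
    exact le_of_mul_le_mul_left this hcard
  rw [← sub_div, abs_div, abs_two]
  linarith

/-- The same with run B's fine-lattice size and averaging count presented freely (`N₂ = L^n·L^k`, `k₂ = k + n` as EQUATIONS) — for consumers whose run B is
«run A one level up» (`L^{k+1} = L·L^k`), where the two presentations of the same operator must be identified. [folklore] -/
theorem abs_action_sub_le_torus_of_eq {a : ℝ} (ha : 0 < a) {L k n : ℕ} [NeZero L] (hL : 2 ≤ L) (hk : 1 ≤ k) (hn : 1 ≤ n) {m2 : ℝ} (hm : 0 < m2)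
    (N₂ : ℕ) [NeZero N₂] (hN₂ : N₂ = L ^ n * L ^ k) (k₂ : ℕ) (hk₂ : k₂ = k + n) (φ : Tor M → ℝ) :
    |φ ⬝ᵥ (effLaplacian (L ^ k) M (aK a L k) (((L ^ k : ℕ) : ℝ) ^ 2) m2 *ᵥ φ) / 2 - φ ⬝ᵥ (effLaplacian N₂ M (aK a L k₂) ((N₂ : ℝ) ^ 2) m2 *ᵥ φ) / 2|
      ≤ thetaK a L k n * a * (φ ⬝ᵥ φ) / 2 := by
  subst hN₂ hk₂
  exact abs_action_sub_le_torus M ha hL hk hn hm φ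

end TorusRuns

/-! ## §3 DENS_cl⁰, the dressed `Core` and N14's binder for King's Gaussian effective measures on the unit torus -/
section KingTorus

variable {d : ℕ} (M : Fin d → ℕ) [hM : ∀ μ, NeZero (M μ)] {ι : Type*} [DecidableEq ι] {l₀ vol B M₀ : ℝ} {T : ℕ → Finset ι} {Bad : ℕ → ℝ → Finset ι}
  {W : ℕ → (Tor M → ℝ) → ℝ} {μ : ℕ → ι → Measure (Tor M → ℝ)} {δ : ℕ → ℝ} {P Q : ℕ → ℝ → ι → ℝ}

/-- **★★ DENS_cl⁰ FOR KING'S TWO RUNS ON THE UNIT TORUS** [folklore ∘ §1–§2]: run A = `k_K` averaging steps (`Δ^{(k_K)}`), run B = `k_K + n` steps (`Δ^{(k_K+n)}`), read on the same unit torus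
`Π ℤ/M_μ`; good classes' reference pieces carried by the small-field class `φ ⬝ᵥ φ ≤ M₀` ⇒ the Gaussian vacuum densities `exp(−½φ·Δφ)` are pointwise sandwiched, centre `0`, radius
`θ_{k_K}·a·M₀/2`. -/
theorem vacuumDens_kingTorus {a : ℝ} (ha : 0 < a) {L n : ℕ} [NeZero L] (hL : 2 ≤ L) (hn : 1 ≤ n) {m2 : ℝ} (hm : 0 < m2) (kA : ℕ → ℕ) (hk : ∀ K, 1 ≤ kA K)
    (hsupp : ∀ (K : ℕ) (t : ℝ), |t| ≤ l₀ → ∀ τ ∈ T K \ Bad K t, ∀ᵐ φ ∂(μ K τ), φ ⬝ᵥ φ ≤ M₀) :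
    ∀ K : ℕ, ∃ c : ℝ, ∀ t : ℝ, |t| ≤ l₀ → ∀ τ ∈ T K \ Bad K t, ∀ᵐ φ ∂(μ K τ),
      Real.exp (c - thetaK a L (kA K) n * a * M₀ / 2) *
          Real.exp (-(φ ⬝ᵥ (effLaplacian (L ^ kA K) M (aK a L (kA K)) (((L ^ kA K : ℕ) : ℝ) ^ 2) m2 *ᵥ φ) / 2)) ≤
        Real.exp (-(φ ⬝ᵥ (effLaplacian (L ^ n * L ^ kA K) M (aK a L (kA K + n)) (((L ^ n * L ^ kA K : ℕ) : ℝ) ^ 2) m2 *ᵥ φ) / 2)) ∧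
      Real.exp (-(φ ⬝ᵥ (effLaplacian (L ^ n * L ^ kA K) M (aK a L (kA K + n)) (((L ^ n * L ^ kA K : ℕ) : ℝ) ^ 2) m2 *ᵥ φ) / 2)) ≤
        Real.exp (c + thetaK a L (kA K) n * a * M₀ / 2) *
          Real.exp (-(φ ⬝ᵥ (effLaplacian (L ^ kA K) M (aK a L (kA K)) (((L ^ kA K : ℕ) : ℝ) ^ 2) m2 *ᵥ φ) / 2)) := by
  refine vacuumDens_of_actionBound (μ := μ)
    (SA := fun K φ => φ ⬝ᵥ (effLaplacian (L ^ kA K) M (aK a L (kA K)) (((L ^ kA K : ℕ) : ℝ) ^ 2) m2 *ᵥ φ) / 2)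
    (SB := fun K φ => φ ⬝ᵥ (effLaplacian (L ^ n * L ^ kA K) M (aK a L (kA K + n)) (((L ^ n * L ^ kA K : ℕ) : ℝ) ^ 2) m2 *ᵥ φ) / 2)
    (r := fun K => thetaK a L (kA K) n * a * M₀ / 2) fun K t ht τ hτ => (hsupp K t ht τ hτ).mono fun φ hφ => ?_
  refine (abs_action_sub_le_torus M ha hL (hk K) hn hm φ).trans ?_
  have : thetaK a L (kA K) n * a * (φ ⬝ᵥ φ) ≤ thetaK a L (kA K) n * a * M₀ :=
    mul_le_mul_of_nonneg_left hφ (mul_nonneg (kingTheta_nonneg ha hL (hk K) hn) ha.le)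
  linarith

/-- **★★ N19's DRESSED `Core` FOR KING'S TWO RUNS ON THE UNIT TORUS** [folklore ∘ §1–§2 + n19-d]: with finite reference pieces, a `B`-bounded measurable unit-scale observable family
`W` and the dressed class partition functions `P K t τ = ∫ exp(−½φ·Δ^{(k_K)}φ)·e^{tW_K φ} dμ_{K,τ}`, `Q` likewise with `Δ^{(k_K+n)}`: `Spine.NE7.Core l₀ vol T Bad P Q δ` for EVERY `t` and any
`vol·δ_K ≥ θ_{k_K}·a·M₀/2`. -/
theorem core_kingTorus {a : ℝ} (ha : 0 < a) {L n : ℕ} [NeZero L] (hL : 2 ≤ L) (hn : 1 ≤ n) {m2 : ℝ} (hm : 0 < m2) (kA : ℕ → ℕ) (hk : ∀ K, 1 ≤ kA K)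
    (hsupp : ∀ (K : ℕ) (t : ℝ), |t| ≤ l₀ → ∀ τ ∈ T K \ Bad K t, ∀ᵐ φ ∂(μ K τ), φ ⬝ᵥ φ ≤ M₀) (hfin : ∀ K, ∀ τ ∈ T K, IsFiniteMeasure (μ K τ))
    (hB : 0 ≤ B) (hWm : ∀ K, Measurable (W K)) (hWb : ∀ K φ, |W K φ| ≤ B)
    (hP : ∀ K (t : ℝ), ∀ τ ∈ T K, P K t τ =
      ∫ φ, Real.exp (-(φ ⬝ᵥ (effLaplacian (L ^ kA K) M (aK a L (kA K)) (((L ^ kA K : ℕ) : ℝ) ^ 2) m2 *ᵥ φ) / 2)) * Real.exp (t * W K φ) ∂(μ K τ))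
    (hQ : ∀ K (t : ℝ), ∀ τ ∈ T K, Q K t τ =
      ∫ φ, Real.exp (-(φ ⬝ᵥ (effLaplacian (L ^ n * L ^ kA K) M (aK a L (kA K + n)) (((L ^ n * L ^ kA K : ℕ) : ℝ) ^ 2) m2 *ᵥ φ) / 2)) *
        Real.exp (t * W K φ) ∂(μ K τ))
    (hδ : ∀ K, thetaK a L (kA K) n * a * M₀ / 2 ≤ vol * δ K) : Core l₀ vol T Bad P Q δ := by
  have hL1 : (1 : ℝ) < L := by exact_mod_cast hL
  have hL0 : L ≠ 0 := NeZero.ne L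
  have hNk : ∀ K, 1 ≤ L ^ kA K := fun K => Nat.one_le_pow _ L (Nat.pos_of_ne_zero hL0)
  have hNkn : ∀ K, 1 ≤ L ^ n * L ^ kA K := fun K => Nat.one_le_iff_ne_zero.2 (Nat.mul_ne_zero (pow_ne_zero n hL0) (pow_ne_zero _ hL0))
  refine core_of_actionBound (μ := μ)
    (SA := fun K φ => φ ⬝ᵥ (effLaplacian (L ^ kA K) M (aK a L (kA K)) (((L ^ kA K : ℕ) : ℝ) ^ 2) m2 *ᵥ φ) / 2)
    (SB := fun K φ => φ ⬝ᵥ (effLaplacian (L ^ n * L ^ kA K) M (aK a L (kA K + n)) (((L ^ n * L ^ kA K : ℕ) : ℝ) ^ 2) m2 *ᵥ φ) / 2)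
    (r := fun K => thetaK a L (kA K) n * a * M₀ / 2)
    (fun K => (measurable_dotProduct_mulVec M _).div_const 2) (fun K => (measurable_dotProduct_mulVec M _).div_const 2)
    (fun K φ => div_nonneg (dotProduct_effLaplacian_nonneg M (L ^ kA K) (hNk K) (aK_pos ha hL1 (hk K)) hm φ) two_pos.le)
    (fun K φ => div_nonneg (dotProduct_effLaplacian_nonneg M (L ^ n * L ^ kA K) (hNkn K) (aK_pos ha hL1 (by have := hk K; omega)) hm φ) two_pos.le)
    (fun K t ht τ hτ => (hsupp K t ht τ hτ).mono fun φ hφ => ?_) hfin hB hWm hWb hP hQ hδ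
  refine (abs_action_sub_le_torus M ha hL (hk K) hn hm φ).trans ?_
  have : thetaK a L (kA K) n * a * (φ ⬝ᵥ φ) ≤ thetaK a L (kA K) n * a * M₀ :=
    mul_le_mul_of_nonneg_left hφ (mul_nonneg (kingTheta_nonneg ha hL (hk K) hn) ha.le)
  linarith

/-- **★★ N14's BINDER FOR KING'S TWO RUNS ON THE UNIT TORUS** [folklore ∘ §1–§2 + n19-d]: the two runs' dressed class laws `μ_{K,τ}.withDensity exp(−½φ·Δ^{(k_K)}φ)` ∕
`… exp(−½φ·Δ^{(k_K+n)}φ)` satisfy `TiltedMeanMatching l₀ T Bad W (run A) W (run B) (K ↦ B·(e^{θ_{k_K}·a·M₀} − 1))` for every `B`-bounded measurable unit-scale observable family —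
with `k_K = K + 1` a SUMMABLE `η` (`KingModelDens.summable_kingRadius`). -/
theorem tiltedMeanMatching_kingTorus {a : ℝ} (ha : 0 < a) {L n : ℕ} [NeZero L] (hL : 2 ≤ L) (hn : 1 ≤ n) {m2 : ℝ} (hm : 0 < m2) (kA : ℕ → ℕ) (hk : ∀ K, 1 ≤ kA K)
    (hM₀ : 0 ≤ M₀) (hsupp : ∀ (K : ℕ) (t : ℝ), |t| ≤ l₀ → ∀ τ ∈ T K \ Bad K t, ∀ᵐ φ ∂(μ K τ), φ ⬝ᵥ φ ≤ M₀)
    (hfin : ∀ K, ∀ τ ∈ T K, IsFiniteMeasure (μ K τ)) (hB : 0 ≤ B) (hWm : ∀ K, Measurable (W K)) (hWb : ∀ K φ, |W K φ| ≤ B) :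
    TiltedMeanMatching l₀ T Bad W
      (fun K τ => (μ K τ).withDensity fun φ =>
        ENNReal.ofReal (Real.exp (-(φ ⬝ᵥ (effLaplacian (L ^ kA K) M (aK a L (kA K)) (((L ^ kA K : ℕ) : ℝ) ^ 2) m2 *ᵥ φ) / 2))))
      W
      (fun K τ => (μ K τ).withDensity fun φ =>
        ENNReal.ofReal (Real.exp (-(φ ⬝ᵥ (effLaplacian (L ^ n * L ^ kA K) M (aK a L (kA K + n)) (((L ^ n * L ^ kA K : ℕ) : ℝ) ^ 2) m2 *ᵥ φ) / 2))))
      fun K => B * (Real.exp (2 * (thetaK a L (kA K) n * a * M₀ / 2)) - 1) := by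
  have hL1 : (1 : ℝ) < L := by exact_mod_cast hL
  have hL0 : L ≠ 0 := NeZero.ne L
  have hNk : ∀ K, 1 ≤ L ^ kA K := fun K => Nat.one_le_pow _ L (Nat.pos_of_ne_zero hL0)
  refine tiltedMeanMatching_of_actionBound (μ := μ)
    (SA := fun K φ => φ ⬝ᵥ (effLaplacian (L ^ kA K) M (aK a L (kA K)) (((L ^ kA K : ℕ) : ℝ) ^ 2) m2 *ᵥ φ) / 2)
    (SB := fun K φ => φ ⬝ᵥ (effLaplacian (L ^ n * L ^ kA K) M (aK a L (kA K + n)) (((L ^ n * L ^ kA K : ℕ) : ℝ) ^ 2) m2 *ᵥ φ) / 2)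
    (r := fun K => thetaK a L (kA K) n * a * M₀ / 2)
    (fun K => (measurable_dotProduct_mulVec M _).div_const 2) (fun K => (measurable_dotProduct_mulVec M _).div_const 2)
    (fun K φ => div_nonneg (dotProduct_effLaplacian_nonneg M (L ^ kA K) (hNk K) (aK_pos ha hL1 (hk K)) hm φ) two_pos.le)
    (fun K => div_nonneg (mul_nonneg (mul_nonneg (kingTheta_nonneg ha hL (hk K) hn) ha.le) hM₀) two_pos.le)
    (fun K t ht τ hτ => (hsupp K t ht τ hτ).mono fun φ hφ => ?_) hfin hB hWm hWb
  refine (abs_action_sub_le_torus M ha hL (hk K) hn hm φ).trans ?_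
  have : thetaK a L (kA K) n * a * (φ ⬝ᵥ φ) ≤ thetaK a L (kA K) n * a * M₀ :=
    mul_le_mul_of_nonneg_left hφ (mul_nonneg (kingTheta_nonneg ha hL (hk K) hn) ha.le)
  linarith

end KingTorus

/-! ## §4 The small-field box as the reference piece: a hypothesis-free King instance -/
section SmallField

variable {d : ℕ} (M : Fin d → ℕ) [hM : ∀ μ, NeZero (M μ)]

omit hM in
/-- King's (3.2) small-field class at the unit scale, `|φ(x)| ≤ R` for all `x`, is the box `Icc (−R) R` of the pi order. [cite: King1986, (3.2) p.655 (the class; bookkeeping)] -/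
theorem smallField_eq_Icc (R : ℝ) : {φ : Tor M → ℝ | ∀ x, |φ x| ≤ R} = Set.Icc (fun _ => -R) (fun _ => R) := by
  ext φ
  simp only [Set.mem_setOf_eq, Set.mem_Icc, Pi.le_def, abs_le]
  exact ⟨fun h => ⟨fun x => (h x).1, fun x => (h x).2⟩, fun h x => ⟨h.1 x, h.2 x⟩⟩

/-- On the small-field class `φ ⬝ᵥ φ ≤ R²·|Tor M|`. [folklore] -/
theorem dotProduct_self_le_of_abs_le {R : ℝ} {φ : Tor M → ℝ} (h : ∀ x, |φ x| ≤ R) : φ ⬝ᵥ φ ≤ R ^ 2 * Fintype.card (Tor M) := by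
  calc φ ⬝ᵥ φ = ∑ x, φ x ^ 2 := by simp [dotProduct, sq]
    _ ≤ ∑ _x : Tor M, R ^ 2 := Finset.sum_le_sum fun x _ => by
        have := h x
        rw [← sq_abs]
        exact pow_le_pow_left₀ (abs_nonneg _) this 2
    _ = R ^ 2 * Fintype.card (Tor M) := by rw [Finset.sum_const, Finset.card_univ, nsmul_eq_mul, mul_comm]

/-- The small-field box has finite Lebesgue volume `(2R)^{|Tor M|}`. [folklore] -/
theorem volume_smallField_lt_top (R : ℝ) : volume {φ : Tor M → ℝ | ∀ x, |φ x| ≤ R} < ∞ := by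
  rw [smallField_eq_Icc M R, Real.volume_Icc_pi]
  exact ENNReal.prod_lt_top fun _ _ => ENNReal.ofReal_lt_top

/-- Lebesgue measure restricted to the small-field box is a finite reference piece carried by `φ ⬝ᵥ φ ≤ R²·|Tor M|`. [folklore] -/
theorem ae_dotProduct_le_smallField (R : ℝ) :
    ∀ᵐ φ ∂((volume : Measure (Tor M → ℝ)).restrict {φ : Tor M → ℝ | ∀ x, |φ x| ≤ R}), φ ⬝ᵥ φ ≤ R ^ 2 * Fintype.card (Tor M) := by
  have hmeas : MeasurableSet {φ : Tor M → ℝ | ∀ x, |φ x| ≤ R} := by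
    rw [smallField_eq_Icc M R]
    exact measurableSet_Icc
  exact (ae_restrict_iff' hmeas).2 (Eventually.of_forall fun φ hφ => dotProduct_self_le_of_abs_le M hφ)

variable {ι : Type*} [DecidableEq ι] {l₀ vol B R : ℝ} {T : ℕ → Finset ι} {Bad : ℕ → ℝ → Finset ι} {W : ℕ → (Tor M → ℝ) → ℝ} {δ : ℕ → ℝ}
  {P Q : ℕ → ℝ → ι → ℝ}

/-- **★★ KING'S SMALL-FIELD GAUSSIAN CLASSES: N19's DRESSED `Core` WITH NO MEASURE HYPOTHESIS** [folklore ∘ §3]: every good class read on the SAME reference piece — Lebesgue measure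
on the small-field box `|φ(x)| ≤ R` — the two runs' dressed class partition functions `P K t τ = ∫_{|φ|≤R} exp(−½φ·Δ^{(k_K)}φ)·e^{tW_K φ} dφ`, `Q` likewise with `Δ^{(k_K+n)}`, satisfy
`Spine.NE7.Core l₀ vol T Bad P Q δ` for every `t` as soon as `vol·δ_K ≥ θ_{k_K}·a·R²|Tor M|/2` (geometric in `k_K`). -/
theorem core_kingTorus_smallField {a : ℝ} (ha : 0 < a) {L n : ℕ} [NeZero L] (hL : 2 ≤ L) (hn : 1 ≤ n) {m2 : ℝ} (hm : 0 < m2) (kA : ℕ → ℕ) (hk : ∀ K, 1 ≤ kA K)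
    (hB : 0 ≤ B) (hWm : ∀ K, Measurable (W K)) (hWb : ∀ K φ, |W K φ| ≤ B)
    (hP : ∀ K (t : ℝ), ∀ τ ∈ T K, P K t τ =
      ∫ φ in {φ : Tor M → ℝ | ∀ x, |φ x| ≤ R}, Real.exp (-(φ ⬝ᵥ (effLaplacian (L ^ kA K) M (aK a L (kA K)) (((L ^ kA K : ℕ) : ℝ) ^ 2) m2 *ᵥ φ) / 2)) *
        Real.exp (t * W K φ))
    (hQ : ∀ K (t : ℝ), ∀ τ ∈ T K, Q K t τ =
      ∫ φ in {φ : Tor M → ℝ | ∀ x, |φ x| ≤ R},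
        Real.exp (-(φ ⬝ᵥ (effLaplacian (L ^ n * L ^ kA K) M (aK a L (kA K + n)) (((L ^ n * L ^ kA K : ℕ) : ℝ) ^ 2) m2 *ᵥ φ) / 2)) * Real.exp (t * W K φ))
    (hδ : ∀ K, thetaK a L (kA K) n * a * (R ^ 2 * Fintype.card (Tor M)) / 2 ≤ vol * δ K) : Core l₀ vol T Bad P Q δ :=
  core_kingTorus M (μ := fun _ _ => (volume : Measure (Tor M → ℝ)).restrict {φ : Tor M → ℝ | ∀ x, |φ x| ≤ R}) ha hL hn hm kA hk
    (fun _ _ _ _ _ => ae_dotProduct_le_smallField M R)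
    (fun _ _ _ => isFiniteMeasure_restrict.2 (volume_smallField_lt_top M R).ne) hB hWm hWb hP hQ hδ

/-- **★★ … AND N14's BINDER** for the two runs' dressed small-field class laws, `η_K = B·(e^{θ_{k_K}·a·R²|Tor M|} − 1)` (summable for `k_K = K+1`, `KingModelDens.summable_kingRadius`). -/
theorem tiltedMeanMatching_kingTorus_smallField {a : ℝ} (ha : 0 < a) {L n : ℕ} [NeZero L] (hL : 2 ≤ L) (hn : 1 ≤ n) {m2 : ℝ} (hm : 0 < m2) (kA : ℕ → ℕ)
    (hk : ∀ K, 1 ≤ kA K) (hB : 0 ≤ B) (hWm : ∀ K, Measurable (W K)) (hWb : ∀ K φ, |W K φ| ≤ B) :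
    TiltedMeanMatching l₀ T Bad W
      (fun K _ => ((volume : Measure (Tor M → ℝ)).restrict {φ : Tor M → ℝ | ∀ x, |φ x| ≤ R}).withDensity fun φ =>
        ENNReal.ofReal (Real.exp (-(φ ⬝ᵥ (effLaplacian (L ^ kA K) M (aK a L (kA K)) (((L ^ kA K : ℕ) : ℝ) ^ 2) m2 *ᵥ φ) / 2))))
      W
      (fun K _ => ((volume : Measure (Tor M → ℝ)).restrict {φ : Tor M → ℝ | ∀ x, |φ x| ≤ R}).withDensity fun φ =>
        ENNReal.ofReal (Real.exp (-(φ ⬝ᵥ (effLaplacian (L ^ n * L ^ kA K) M (aK a L (kA K + n)) (((L ^ n * L ^ kA K : ℕ) : ℝ) ^ 2) m2 *ᵥ φ) / 2))))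
      fun K => B * (Real.exp (2 * (thetaK a L (kA K) n * a * (R ^ 2 * Fintype.card (Tor M)) / 2)) - 1) :=
  tiltedMeanMatching_kingTorus M (μ := fun _ _ => (volume : Measure (Tor M → ℝ)).restrict {φ : Tor M → ℝ | ∀ x, |φ x| ≤ R}) ha hL hn hm kA hk
    (by positivity) (fun _ _ _ _ _ => ae_dotProduct_le_smallField M R) (fun _ _ _ => isFiniteMeasure_restrict.2 (volume_smallField_lt_top M R).ne) hB hWm hWb

/-- **★★ THE N19′ CORE EDGE's CONCLUSION SHAPE, INHABITED IN THE PRINTED MODEL** [folklore ∘ §4 + `KingModelDens.summable_kingRadius`]: for CONSECUTIVE King runs (`k_K = K + 1`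
averaging steps vs `K + 1 + n`) read on the small-field Gaussian classes of the unit torus, `∃ δ, Spine.NE7.Core l₀ vol T Bad P Q δ ∧ Summable δ` — the `∃ δ, Core … ∧ Summable δ`
shape of the K3⁗ skeleton's keyed core edge, with `δ_K = θ_{K+1}·a·R²|Tor M|/(2·vol)` GEOMETRIC (`thetaK_le`). -/
theorem exists_core_summable_kingTorus_smallField {a : ℝ} (ha : 0 < a) {L n : ℕ} [NeZero L] (hL : 2 ≤ L) (hn : 1 ≤ n) {m2 : ℝ} (hm : 0 < m2) (hvol : 0 < vol)
    (hB : 0 ≤ B) (hWm : ∀ K, Measurable (W K)) (hWb : ∀ K φ, |W K φ| ≤ B)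
    (hP : ∀ K (t : ℝ), ∀ τ ∈ T K, P K t τ =
      ∫ φ in {φ : Tor M → ℝ | ∀ x, |φ x| ≤ R}, Real.exp (-(φ ⬝ᵥ (effLaplacian (L ^ (K + 1)) M (aK a L (K + 1)) (((L ^ (K + 1) : ℕ) : ℝ) ^ 2) m2 *ᵥ φ) / 2)) *
        Real.exp (t * W K φ))
    (hQ : ∀ K (t : ℝ), ∀ τ ∈ T K, Q K t τ =
      ∫ φ in {φ : Tor M → ℝ | ∀ x, |φ x| ≤ R},
        Real.exp (-(φ ⬝ᵥ (effLaplacian (L ^ n * L ^ (K + 1)) M (aK a L (K + 1 + n)) (((L ^ n * L ^ (K + 1) : ℕ) : ℝ) ^ 2) m2 *ᵥ φ) / 2)) *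
          Real.exp (t * W K φ)) :
    ∃ δ : ℕ → ℝ, Core l₀ vol T Bad P Q δ ∧ Summable δ := by
  refine ⟨fun K => thetaK a L (K + 1) n * a * (R ^ 2 * Fintype.card (Tor M)) / 2 / vol, ?_, ?_⟩
  · exact core_kingTorus_smallField M ha hL hn hm (fun K => K + 1) (fun K => by omega) hB hWm hWb hP hQ fun K =>
      le_of_eq (by field_simp)
  · exact (summable_kingRadius ha hL hn (M := R ^ 2 * Fintype.card (Tor M)) (by positivity) B).1.div_const vol

end SmallField

end YMDAG.N18.KingModelDensTorus

end
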